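import Summits.Ventures.CertifiedArithmetic.Expansions.EstimateWeakExpansion

/-!
# The absolute error of `estimate` on a nonoverlapping expansion: `|estimate − Σ| ≤ u·2^s`

NEW WORK in the sense of this development (the routine `estimate` of `predicates.c` is
Shewchuk's; the statements and proofs are ours).  `EstimateWeakExpansion.lean` proved
`|estimate| ≤ 2^s` for a nonoverlapping expansion of floats with components `< 2^s`, and from it
that `estimate` is sign-faithful on weakly nonoverlapping expansions.  THIS FILE is the
quantitative companion, used by `EstimateRelativeError.lean` (`|estimate − Σ| ≤ 3u·|Σ|` on `W`
expansions):
* `abs_fl_sub_le_half_u_two_zpow` — a multiple of `2^emin` of magnitude `≤ 2^s` is rounded with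
  error `≤ (u/2)·2^s` (it is a float, or it lies strictly inside `(−2^s, 2^s)`, where half an
  ulp is `2^(s−p−1)`); `p ≥ 1`, any round-to-nearest;
* `isFloat_add_of_two_zpow_le_abs` — a float `Q` with `|Q| ≥ 2^(v−1)` plus a multiple of `2^v`
  is again a float as soon as the sum is `< 2^v` in magnitude (an EXACT addition: both live on
  the grid of `Q`'s quantum `≥ 2^(v−p)`);
* `abs_estimate_sub_sum_le_of_isExpansion` — **`|estimate − Σ| ≤ u·2^s`** for every
  nonoverlapping expansion (`IsExpansion 1`) of floats with components `< 2^s` (`u = 2^−p`,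
  `p ≥ 1`, any round-to-nearest, any length);
* `abs_estimate_step_le_of_two_zpow_le` — the relative form of one summation step: components
  `< 2^t` and `2^t ≤ |Σ + a|` give `|estimate ⊕ a − (Σ + a)| ≤ (2 + u)·u·|Σ + a| ≤ 3u·|Σ + a|`.

PROOF of the `u·2^s` bound (induction from the right, as for `|estimate| ≤ 2^s`): the top
component is `a = M·2^v` with `M` odd, so `2·2^v ≤ 2^s`; the earlier components lie below
`2^v`, so their `estimate` `Q` satisfies `|Q − Σ'| ≤ u·2^v ≤ (u/2)·2^s` by induction and
`|Q + a| ≤ 2^v + (2^s − 2^v) = 2^s` by grid separation; the last rounding adds `≤ (u/2)·2^s`.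

Reference for the routine: J. R. Shewchuk, Discrete Comput. Geom. 18 (1997) 305–363, §2.7 and
`predicates.c` (`estimate`) [Shewchuk1997].  As in the earlier files the algorithms are modelled
as our own definitions over `ℚ` with an abstract round-to-nearest `fl` into `F(p, emin)`
(no overflow); nothing is claimed about the C code itself.
-/

namespace Summit.Ventures.CertifiedArithmetic.Expansions

open Literature.ComputerArithmetic.JeannerodRump2018
open Literature.ComputerArithmetic.BoldoJeannerodMelquiondMuller2023 hiding twoSum twoSum_fst
  isFloat_twoSum
open Literature.ComputerArithmetic.JoldesMullerPopescu2017 (isFloat_two_zpow abs_fl_le_of_abs_le)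
open Literature.ComputerArithmetic.JeannerodLouvetMuller2013 (ulp_le_two_zpow)
open Literature.ComputerArithmetic.Shewchuk1997

variable {p : ℕ} {emin : ℤ} {fl : ℚ → ℚ}

/-! ## Two rounding facts -/

/-- Rounding a multiple of `2^emin` of magnitude at most `2^s` errs by at most `(u/2)·2^s`
(`p ≥ 1`): either the value is a float, or `|·| < 2^s` strictly and half an ulp is `2^(s−p−1)`. -/
theorem abs_fl_sub_le_half_u_two_zpow (hp : 1 ≤ p) (hfl : IsRoundNearest p emin fl) {x : ℚ}
    (hx : OnGrid emin x) {s : ℤ} (hs : |x| ≤ (2 : ℚ) ^ s) :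
    |fl x - x| ≤ unitRoundoff p / 2 * (2 : ℚ) ^ s := by
  have hu : unitRoundoff p / 2 * (2 : ℚ) ^ s = (2 : ℚ) ^ (s - p) / 2 := by
    unfold unitRoundoff
    rw [zpow_sub₀ (by norm_num : (2 : ℚ) ≠ 0), zpow_natCast]; ring
  by_cases hF : IsFloat p emin x
  · rw [fl_eq_self hfl hF, sub_self, abs_zero, hu]
    exact div_nonneg (zpow_nonneg (by norm_num) _) (by norm_num)
  have hbig : (2 : ℚ) ^ (emin + p) ≤ |x| := two_zpow_le_abs_of_onGrid_of_not_isFloat le_rfl hx hF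
  have hes : emin ≤ s := by
    by_contra h
    have h1 : (2 : ℚ) ^ s < (2 : ℚ) ^ emin := zpow_lt_zpow_right₀ (by norm_num) (by omega)
    have h2 : (2 : ℚ) ^ emin ≤ (2 : ℚ) ^ (emin + p) :=
      zpow_le_zpow_right₀ (by norm_num) (by omega)
    linarith
  have hlt : |x| < (2 : ℚ) ^ s := by
    refine lt_of_le_of_ne hs fun h => hF ?_
    rcases (abs_eq (zpow_nonneg (by norm_num) s)).mp h with h' | h'
    · rw [h']; exact isFloat_two_zpow hp hes
    · rw [h']; exact (isFloat_two_zpow hp hes).neg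
  have hsp : emin ≤ s - p := by
    have := (zpow_lt_zpow_iff_right₀ (by norm_num : (1 : ℚ) < 2)).mp (hbig.trans_lt hlt)
    omega
  have hps : (2 : ℚ) ^ p * (2 : ℚ) ^ (s - p) = (2 : ℚ) ^ s := by
    rw [← zpow_natCast, ← zpow_add₀ (by norm_num : (2 : ℚ) ≠ 0)]; congr 1; ring
  have hulp : ulp p emin x ≤ (2 : ℚ) ^ (s - p) := ulp_le_two_zpow hsp (by rw [hps]; exact hlt)
  rw [abs_sub_comm, hu]
  exact (abs_sub_fl_le_half_ulp hp hfl x).trans (by linarith)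

/-- A float `Q` with `2^(v−1) ≤ |Q|` plus a multiple `a` of `2^v` (`v ≥ emin`) is again a float as
soon as `|Q + a| < 2^v`: both live on the grid of `Q`'s quantum, which is at least `2^(v−p)`. -/
theorem isFloat_add_of_two_zpow_le_abs {Q : ℚ} (hQ : IsFloat p emin Q) {v : ℤ} (hv : emin ≤ v)
    (hQv : (2 : ℚ) ^ (v - 1) ≤ |Q|) {a : ℚ} (ha : OnGrid v a) (hR : |Q + a| < (2 : ℚ) ^ v) :
    IsFloat p emin (Q + a) := by
  obtain ⟨N, e, hN, he, hQe⟩ := hQ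
  have h2e : (0 : ℚ) < (2 : ℚ) ^ e := zpow_pos (by norm_num) e
  -- the quantum `2^e` of `Q` is at least `2^(v-p)`
  have hev : v - p ≤ e := by
    by_contra h
    have hN' : |(N : ℚ)| < (2 : ℚ) ^ (p : ℤ) := by
      rw [zpow_natCast, ← Int.cast_abs]; exact_mod_cast hN
    have h1 : |Q| < (2 : ℚ) ^ (e + p) := by
      rw [hQe, abs_mul, abs_of_pos h2e, zpow_add₀ (by norm_num : (2 : ℚ) ≠ 0),
        mul_comm ((2 : ℚ) ^ e)]
      exact mul_lt_mul_of_pos_right hN' h2e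
    have h2 : (2 : ℚ) ^ (e + p) ≤ (2 : ℚ) ^ (v - 1) :=
      zpow_le_zpow_right₀ (by norm_num) (by omega)
    linarith
  -- work on the common grid `2^(min e v)`
  have hG : OnGrid (min e v) (Q + a) :=
    ((show OnGrid e Q from ⟨N, hQe⟩).mono (min_le_left e v)).add (ha.mono (min_le_right e v))
  by_contra hnf
  have h3 := two_zpow_le_abs_of_onGrid_of_not_isFloat (le_min he hv) hG hnf
  have h4 : (2 : ℚ) ^ v ≤ (2 : ℚ) ^ (min e v + p) := by
    refine zpow_le_zpow_right₀ (by norm_num) ?_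
    rcases le_total e v with h | h
    · rw [min_eq_left h]; omega
    · rw [min_eq_right h]; omega
  linarith

/-! ## The absolute error of `estimate` on a nonoverlapping expansion -/

/-- **`|estimate − Σ| ≤ u·2^s`** for a nonoverlapping expansion of floats all of whose components
are `< 2^s` in magnitude (`p ≥ 1`, any round-to-nearest).  By induction from the right: the top
component is `M·2^v` (`M` odd) with `2·2^v ≤ 2^s`, the earlier ones are `< 2^v` (error `≤ u·2^v`
by induction), and the final rounding of a value `≤ 2^s` in magnitude errs by `≤ (u/2)·2^s`. -/
theorem abs_estimate_sub_sum_le_of_isExpansion (hp : 1 ≤ p) (hfl : IsRoundNearest p emin fl) :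
    ∀ {l : List ℚ}, (∀ x ∈ l, IsFloat p emin x) → IsExpansion 1 l →
      ∀ {s : ℤ}, (∀ x ∈ l, |x| < (2 : ℚ) ^ s) →
        |estimate fl l - l.sum| ≤ unitRoundoff p * (2 : ℚ) ^ s := by
  have hu0 : 0 ≤ unitRoundoff p := by unfold unitRoundoff; positivity
  intro l
  induction l using List.reverseRecOn with
  | nil =>
    intro _ _ s _
    rw [show estimate fl [] = 0 from rfl, List.sum_nil, sub_zero, abs_zero]
    exact mul_nonneg hu0 (zpow_nonneg (by norm_num) _)
  | append_singleton l a ih =>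
    intro hF hE s hs
    have hFl : ∀ x ∈ l, IsFloat p emin x := fun x hx => hF x (by simp [hx])
    have hFa : IsFloat p emin a := hF a (by simp)
    have hEl : IsExpansion 1 l := (List.pairwise_append.mp hE).1
    have hbelow : ∀ x ∈ l, Below 1 x a := fun x hx =>
      (List.pairwise_append.mp hE).2.2 x hx a (by simp)
    have hsl : ∀ x ∈ l, |x| < (2 : ℚ) ^ s := fun x hx => hs x (by simp [hx])
    have hsa : |a| < (2 : ℚ) ^ s := hs a (by simp)
    rw [List.sum_append, List.sum_singleton]
    by_cases hl : l = []
    · subst hl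
      rw [show estimate fl ([] ++ [a]) = a from rfl, List.sum_nil, zero_add, sub_self, abs_zero]
      exact mul_nonneg hu0 (zpow_nonneg (by norm_num) _)
    rw [estimate_append_singleton fl hl]
    have hQF : IsFloat p emin (estimate fl l) := isFloat_estimate hfl hFl
    by_cases ha0 : a = 0
    · rw [ha0, add_zero, add_zero, fl_eq_self hfl hQF]; exact ih hFl hEl hsl
    obtain ⟨M, v, hMo, -, -, hav⟩ := exists_odd_mul_two_zpow hFa ha0
    -- every earlier component lies below `2^v`
    have hv : ∀ x ∈ l, |x| < (2 : ℚ) ^ v := fun x hx => by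
      obtain ⟨s', hs', hxs'⟩ := hbelow x hx
      rw [one_mul] at hxs'
      rw [hav] at hs'
      exact lt_of_lt_of_le hxs' (zpow_le_zpow_right₀ (by norm_num) (OnGrid.le_of_odd hMo hs'))
    have hQv : |estimate fl l| ≤ (2 : ℚ) ^ v := abs_estimate_le_two_zpow hp hfl hFl hEl hv
    have hIH : |estimate fl l - l.sum| ≤ unitRoundoff p * (2 : ℚ) ^ v := ih hFl hEl hv
    have h2v : (0 : ℚ) < (2 : ℚ) ^ v := zpow_pos (by norm_num) _
    have hM0 : M ≠ 0 := by rintro rfl; obtain ⟨k, hk⟩ := hMo; omega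
    have hM1 : (1 : ℚ) ≤ |(M : ℚ)| := by
      rw [← Int.cast_abs]; exact_mod_cast Int.one_le_abs hM0
    have hva : (2 : ℚ) ^ v ≤ |a| := by
      rw [hav, abs_mul, abs_of_pos h2v]; exact le_mul_of_one_le_left h2v.le hM1
    have hvs : v < s :=
      (zpow_lt_zpow_iff_right₀ (by norm_num : (1 : ℚ) < 2)).mp (hva.trans_lt hsa)
    have h2vs : 2 * (2 : ℚ) ^ v ≤ (2 : ℚ) ^ s := by
      rw [mul_comm, ← zpow_add_one₀ (by norm_num : (2 : ℚ) ≠ 0)]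
      exact zpow_le_zpow_right₀ (by norm_num) (by omega)
    -- `a` and `2^s` are multiples of `2^v`, so `|estimate l + a| ≤ 2^v + (2^s − 2^v) = 2^s`
    have haG : OnGrid v a := ⟨M, hav⟩
    have hsG : OnGrid v ((2 : ℚ) ^ s) := OnGrid.two_zpow hvs.le
    have hup : a + (2 : ℚ) ^ v ≤ (2 : ℚ) ^ s := haG.add_two_zpow_le hsG (lt_of_abs_lt hsa)
    have hlo : -(2 : ℚ) ^ s + (2 : ℚ) ^ v ≤ a :=
      hsG.neg.add_two_zpow_le haG (neg_lt_of_abs_lt hsa)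
    have hQa : |estimate fl l + a| ≤ (2 : ℚ) ^ s := by
      obtain ⟨hQ1, hQ2⟩ := abs_le.mp hQv
      rw [abs_le]; constructor <;> linarith
    have hδ := abs_fl_sub_le_half_u_two_zpow hp hfl
      ((OnGrid.of_isFloat hQF).add (OnGrid.of_isFloat hFa)) hQa
    have hmul := mul_le_mul_of_nonneg_left h2vs hu0
    calc |fl (estimate fl l + a) - (l.sum + a)|
        = |(fl (estimate fl l + a) - (estimate fl l + a)) + (estimate fl l - l.sum)| := by
          congr 1; ring
      _ ≤ |fl (estimate fl l + a) - (estimate fl l + a)| + |estimate fl l - l.sum| :=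
          abs_add_le _ _
      _ ≤ unitRoundoff p / 2 * (2 : ℚ) ^ s + unitRoundoff p * (2 : ℚ) ^ v := add_le_add hδ hIH
      _ ≤ unitRoundoff p * (2 : ℚ) ^ s := by linarith

/-- ONE SUMMATION STEP IN RELATIVE FORM: if the earlier components (a nonoverlapping expansion of
floats) lie below `2^t` and the true total is at least `2^t` in magnitude, then
`|estimate ⊕ a − Σ| ≤ (2 + u)·u·|Σ| ≤ 3u·|Σ|` (`p ≥ 1`). -/
theorem abs_estimate_step_le_of_two_zpow_le (hp : 1 ≤ p) (hfl : IsRoundNearest p emin fl)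
    {l : List ℚ} (hFl : ∀ x ∈ l, IsFloat p emin x) (hEl : IsExpansion 1 l) {a : ℚ}
    (hFa : IsFloat p emin a) {t : ℤ} (ht : ∀ x ∈ l, |x| < (2 : ℚ) ^ t)
    (hS : (2 : ℚ) ^ t ≤ |l.sum + a|) :
    |fl (estimate fl l + a) - (l.sum + a)| ≤ 3 * unitRoundoff p * |l.sum + a| := by
  have hu0 : 0 ≤ unitRoundoff p := by unfold unitRoundoff; positivity
  have hu1 : unitRoundoff p ≤ 1 := by
    unfold unitRoundoff
    rw [div_le_one (by positivity)]; exact one_le_pow₀ (by norm_num)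
  have hQF : IsFloat p emin (estimate fl l) := isFloat_estimate hfl hFl
  have hε : |estimate fl l - l.sum| ≤ unitRoundoff p * |l.sum + a| :=
    (abs_estimate_sub_sum_le_of_isExpansion hp hfl hFl hEl ht).trans
      (mul_le_mul_of_nonneg_left hS hu0)
  have hδ : |estimate fl l + a - fl (estimate fl l + a)| ≤
      unitRoundoff p * |estimate fl l + a| :=
    abs_sub_fl_le_eps_mul_abs hp hfl le_rfl ((OnGrid.of_isFloat hQF).add (OnGrid.of_isFloat hFa))
  have hR : |estimate fl l + a| ≤ |l.sum + a| + |estimate fl l - l.sum| := by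
    calc |estimate fl l + a| = |(l.sum + a) + (estimate fl l - l.sum)| := by congr 1; ring
      _ ≤ |l.sum + a| + |estimate fl l - l.sum| := abs_add_le _ _
  have hδ' : |estimate fl l + a - fl (estimate fl l + a)| ≤
      unitRoundoff p * (|l.sum + a| + unitRoundoff p * |l.sum + a|) :=
    hδ.trans (mul_le_mul_of_nonneg_left (hR.trans (by linarith)) hu0)
  have hSS : 0 ≤ |l.sum + a| := abs_nonneg _
  have huu : unitRoundoff p * (unitRoundoff p * |l.sum + a|) ≤ 1 * (unitRoundoff p * |l.sum + a|) :=
    mul_le_mul_of_nonneg_right hu1 (mul_nonneg hu0 hSS)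
  calc |fl (estimate fl l + a) - (l.sum + a)|
      = |-(estimate fl l + a - fl (estimate fl l + a)) + (estimate fl l - l.sum)| := by
        congr 1; ring
    _ ≤ |-(estimate fl l + a - fl (estimate fl l + a))| + |estimate fl l - l.sum| := abs_add_le _ _
    _ = |estimate fl l + a - fl (estimate fl l + a)| + |estimate fl l - l.sum| := by rw [abs_neg]
    _ ≤ 3 * unitRoundoff p * |l.sum + a| := by linarith

end Summit.Ventures.CertifiedArithmetic.Expansions
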